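import Literature.Analysis.FluidPDE.StatisticalSolutionEnergyEq
import Literature.Analysis.FluidPDE.CylindricalGenerator
import Summits.AnomalousDissipation.AnomalousDissipation.Theorems.StirringSphereEnsembleRealizationStubAugCurrentProfile
import Summits.AnomalousDissipation.AnomalousDissipation.Theorems.StirringSphereEnsembleRealizationStubAugCurrentKernel
import Summits.AnomalousDissipation.AnomalousDissipation.Theorems.StirringSphereEnsembleRealizationStubAugCurrentField

/-!
# Crux `EnsembleRealization` (stmt-AnomalousDissipation-0215) — line `augmented-lift`,
# sub-stub (M1a) `stub_augCurrentLevelPairs`, piece (L3)/Entry: entries of the augmented current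

Supports stmt-AnomalousDissipation-0215 (stub `stub_augCurrentLevelPairs` of line
`augmented-lift`, piece L3 `stub_augCurrentLevelCurrentTools`, step (A3) of
`augCurrent-notes.md` §3). Nothing here closes an item. Theorems only.

One level of the construction: smooth solenoidal mean-zero fields `g₀, …, g_{D-1}` with Bessel
coordinates `ξ(u) = ((u, gⱼ))ⱼ`, the a.e. ball `‖u‖ ≤ R` of the Foias–Prodi law `μ`, the
cylindrical energy inequalities `CEI(ν, f, μ)` and a width `δ > 0`. With the one-sided product
mollifier `ρ = ρ₁ ⊗ ρ₂` and the energy primitive `P₂` of `stub_augCurrentProfileTools` and the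
coordinate map `Z u = (ξ(u), ‖u‖²)`, the CURRENT is
`J_w,j(z) = ∫ ρ(z − Z u) ⟨F(u), gⱼ⟩ dμ`, `J_e(z) = −Σⱼ ∫ (∂ⱼρ₁ ⊗ P₂)(z − Z u) ⟨F(u), gⱼ⟩ dμ`, and
the mollified law is `p₁(z) = ∫ ρ(z − Z u) dμ`. This file proves: `C¹` regularity
(`stub_augCurrentKernelTools`), support in the box `closedBall 0 (R + δ) ×ˢ [0, R² + δ]` (ball
bound below, `CEI(±ρ₁)` above the energy range), vanishing classical divergence
(`∂_e (∂ⱼρ₁ ⊗ P₂) = ∂ⱼρ₁ ⊗ ρ₂`), unit mass of `p₁` (Tonelli), the CEI inequality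
`J_e + 2 ∫ ρ(· − Z u)(ν‖u‖_V² − (u, f)) dμ ≤ 0` (`CEI(ψ_z)`, `ψ_z = −ρ₁(w − ·) P₂(e − ·)`) and the
rate bound `‖𝓕(Σⱼ J_w,j gⱼ)(k)‖ ≤ L k · p₁`. Packaged as `stub_augCurrentLevelCurrentTools`.
-/

noncomputable section

set_option linter.dupNamespace false

open MeasureTheory Set Filter Topology Function Metric UnitAddTorus
open scoped BigOperators ENNReal InnerProductSpace RealInnerProductSpace

namespace Summit.AnomalousDissipation.AnomalousDissipation.Theorems.EnsembleRealization

open Literature.Analysis.FunctionSpaces Literature.Analysis.FunctionSpaces.Torus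
open Literature.Analysis.FluidPDE Literature.Analysis.FluidPDE.Torus

/-! ### Tensor kernels `ρ₁ ⊗ ρ₂` on `E₁ × ℝ` -/

/-- Derivative of a tensor kernel `y ↦ a(y.1) b(y.2)`: differentiability, the value of the
derivative on `(v, s)`, and an operator-norm bound. -/
theorem fderiv_tensorKernel {E₁ : Type*} [NormedAddCommGroup E₁] [NormedSpace ℝ E₁]
    {a : E₁ → ℝ} {b : ℝ → ℝ} {b' : ℝ} (y : E₁ × ℝ)
    (ha : DifferentiableAt ℝ a y.1) (hb : HasDerivAt b b' y.2) :
    DifferentiableAt ℝ (fun y : E₁ × ℝ => a y.1 * b y.2) y ∧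
    (∀ v s, fderiv ℝ (fun y : E₁ × ℝ => a y.1 * b y.2) y (v, s) = fderiv ℝ a y.1 v * b y.2 + a y.1 * (b' * s)) ∧
    ‖fderiv ℝ (fun y : E₁ × ℝ => a y.1 * b y.2) y‖ ≤ ‖fderiv ℝ a y.1‖ * |b y.2| + |a y.1| * |b'| := by
  have h1 : HasFDerivAt (fun y : E₁ × ℝ => a y.1) ((fderiv ℝ a y.1).comp (ContinuousLinearMap.fst ℝ E₁ ℝ)) y :=
    ha.hasFDerivAt.comp y hasFDerivAt_fst
  have h2 : HasFDerivAt (fun y : E₁ × ℝ => b y.2)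
      ((ContinuousLinearMap.smulRight (1 : ℝ →L[ℝ] ℝ) b').comp (ContinuousLinearMap.snd ℝ E₁ ℝ)) y :=
    hb.hasFDerivAt.comp y hasFDerivAt_snd
  have h : HasFDerivAt (fun y : E₁ × ℝ => a y.1 * b y.2) (a y.1 • (ContinuousLinearMap.smulRight
      (1 : ℝ →L[ℝ] ℝ) b').comp (ContinuousLinearMap.snd ℝ E₁ ℝ) +
        b y.2 • (fderiv ℝ a y.1).comp (ContinuousLinearMap.fst ℝ E₁ ℝ)) y := h1.mul h2
  have hval : ∀ v s, fderiv ℝ (fun y : E₁ × ℝ => a y.1 * b y.2) y (v, s) =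
      fderiv ℝ a y.1 v * b y.2 + a y.1 * (b' * s) := fun v s => by
    rw [h.fderiv]
    simp only [add_apply, FunLike.coe_smul, Pi.smul_apply,
      ContinuousLinearMap.comp_apply, ContinuousLinearMap.coe_fst', ContinuousLinearMap.coe_snd',
      ContinuousLinearMap.smulRight_apply, one_apply_eq_self, smul_eq_mul]
    ring
  refine ⟨h.differentiableAt, hval, ContinuousLinearMap.opNorm_le_bound _ (by positivity) fun w => ?_⟩
  obtain ⟨v, s⟩ := w
  rw [hval, Real.norm_eq_abs]
  have hv : ‖v‖ ≤ ‖(v, s)‖ := norm_fst_le (v, s)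
  have hs : |s| ≤ ‖(v, s)‖ := by have h := norm_snd_le (v, s); rwa [Real.norm_eq_abs] at h
  have h3 : |fderiv ℝ a y.1 v| ≤ ‖fderiv ℝ a y.1‖ * ‖(v, s)‖ :=
    (Real.norm_eq_abs _ ▸ (fderiv ℝ a y.1).le_opNorm v).trans
      (mul_le_mul_of_nonneg_left hv (norm_nonneg _))
  calc |fderiv ℝ a y.1 v * b y.2 + a y.1 * (b' * s)|
      ≤ |fderiv ℝ a y.1 v| * |b y.2| + |a y.1| * (|b'| * |s|) := by
        rw [← abs_mul, ← abs_mul, ← abs_mul]; exact abs_add_le _ _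
    _ ≤ ‖fderiv ℝ a y.1‖ * ‖(v, s)‖ * |b y.2| + |a y.1| * (|b'| * ‖(v, s)‖) := by
        gcongr
    _ = (‖fderiv ℝ a y.1‖ * |b y.2| + |a y.1| * |b'|) * ‖(v, s)‖ := by ring

/-- A `C¹` tensor kernel with bounded factors and bounded factor derivatives is bounded with
bounded derivative: the hypothesis `hκK` of `stub_augCurrentKernelTools`. -/
theorem tensorKernel_bounds {E₁ : Type*} [NormedAddCommGroup E₁] [NormedSpace ℝ E₁]
    {a : E₁ → ℝ} (ha : ContDiff ℝ 1 a) {b ρ : ℝ → ℝ} (hb : ∀ s, HasDerivAt b (ρ s) s)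
    {A B C : ℝ} (hA : ∀ x, |a x| ≤ A ∧ ‖fderiv ℝ a x‖ ≤ A) (hB : ∀ s, |b s| ≤ B) (hC : ∀ s, |ρ s| ≤ C) :
    ∀ y : E₁ × ℝ, |a y.1 * b y.2| ≤ A * B + A * C ∧
      ‖fderiv ℝ (fun y : E₁ × ℝ => a y.1 * b y.2) y‖ ≤ A * B + A * C := by
  intro y
  have hA0 : 0 ≤ A := (abs_nonneg _).trans (hA y.1).1
  have hB0 : 0 ≤ B := (abs_nonneg _).trans (hB y.2)
  have hC0 : 0 ≤ C := (abs_nonneg _).trans (hC y.2)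
  obtain ⟨-, -, hn⟩ := fderiv_tensorKernel y ((ha.differentiable one_ne_zero) y.1) (hb y.2)
  refine ⟨?_, hn.trans ?_⟩
  · rw [abs_mul]
    nlinarith [(hA y.1).1, hB y.2, abs_nonneg (a y.1), abs_nonneg (b y.2), mul_nonneg hA0 hC0]
  · nlinarith [(hA y.1).1, (hA y.1).2, hB y.2, hC y.2, abs_nonneg (a y.1), abs_nonneg (b y.2),
      norm_nonneg (fderiv ℝ a y.1), abs_nonneg (ρ y.2)]

/-- A tensor kernel is `C¹` if the first factor is `C¹` and the second has a continuous
derivative. -/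
theorem contDiff_tensorKernel {E₁ : Type*} [NormedAddCommGroup E₁] [NormedSpace ℝ E₁]
    {a : E₁ → ℝ} (ha : ContDiff ℝ 1 a) {b : ℝ → ℝ} (hb : ContDiff ℝ 1 b) :
    ContDiff ℝ 1 fun y : E₁ × ℝ => a y.1 * b y.2 :=
  (ha.comp contDiff_fst).mul (hb.comp contDiff_snd)

/-! ### Entries `z ↦ ∫ κ(z − Z u) F(u) dμ`: evaluation of the derivative, mass, vanishing -/

/-- **Directional derivatives of an entry.** Under the hypotheses of `stub_augCurrentKernelTools`,
`D(∫ κ(· − Z u) F(u) dμ)(z)[v] = ∫ F(u) Dκ(z − Z u)[v] dμ`. -/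
theorem fderiv_entry_apply {Ω : Type*} [MeasurableSpace Ω] (μ : Measure Ω) [IsFiniteMeasure μ]
    {E : Type*} [NormedAddCommGroup E] [NormedSpace ℝ E] [FiniteDimensional ℝ E]
    [MeasurableSpace E] [BorelSpace E]
    {Z : Ω → E} (hZ : Measurable Z) {F : Ω → ℝ} (hF : AEStronglyMeasurable F μ) {M : ℝ}
    (hFM : ∀ᵐ u ∂μ, |F u| ≤ M) {κ : E → ℝ} (hκ : ContDiff ℝ 1 κ) {K : ℝ}
    (hκK : ∀ y, |κ y| ≤ K ∧ ‖fderiv ℝ κ y‖ ≤ K) (z v : E) :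
    (∫ u, F u • fderiv ℝ κ (z - Z u) ∂μ) v = ∫ u, F u * fderiv ℝ κ (z - Z u) v ∂μ ∧
    fderiv ℝ (fun z => ∫ u, κ (z - Z u) * F u ∂μ) z v = ∫ u, F u * fderiv ℝ κ (z - Z u) v ∂μ := by
  obtain ⟨hder, -, -⟩ := stub_augCurrentKernelTools μ hZ hF hFM hκ hκK
  rw [(hder z).fderiv, and_self_iff]
  have hDκc : Continuous (fderiv ℝ κ) := hκ.continuous_fderiv one_ne_zero
  have hmeas : AEStronglyMeasurable (fun u => F u • fderiv ℝ κ (z - Z u)) μ :=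
    hF.smul ((hDκc.comp (continuous_const.sub continuous_id)).comp_aestronglyMeasurable hZ.aestronglyMeasurable)
  have hint : Integrable (fun u => F u • fderiv ℝ κ (z - Z u)) μ :=
    Integrable.of_bound hmeas (C := M * K) (hFM.mono fun u hu => by
      rw [norm_smul, Real.norm_eq_abs]
      exact mul_le_mul hu (hκK _).2 (norm_nonneg _) ((abs_nonneg _).trans hu))
  rw [ContinuousLinearMap.integral_apply hint]
  simp only [FunLike.coe_smul, Pi.smul_apply, smul_eq_mul]

/-- **Mass of a mollified law.** For a probability measure `μ`, a measurable coordinate map `Z`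
and a continuous integrable kernel `κ` on a finite-dimensional space with a right-invariant
measure `vol`: `∫ (∫ κ(z − Z u) dμ) dvol(z) = ∫ κ dvol` (Tonelli and translation invariance). -/
theorem integral_integral_kernel_sub {Ω : Type*} [MeasurableSpace Ω] (μ : Measure Ω) [IsProbabilityMeasure μ]
    {E : Type*} [NormedAddCommGroup E] [NormedSpace ℝ E] [FiniteDimensional ℝ E]
    [MeasurableSpace E] [BorelSpace E] (vol : Measure E) [SFinite vol] [vol.IsAddRightInvariant]
    {Z : Ω → E} (hZ : Measurable Z) {κ : E → ℝ} (hκ : Continuous κ) (hκi : Integrable κ vol) :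
    ∫ z, ∫ u, κ (z - Z u) ∂μ ∂vol = ∫ y, κ y ∂vol := by
  have hm : AEStronglyMeasurable (uncurry fun z u => κ (z - Z u)) (vol.prod μ) :=
    (hκ.measurable.comp (measurable_fst.sub (hZ.comp measurable_snd))).aestronglyMeasurable
  have hint : Integrable (uncurry fun z u => κ (z - Z u)) (vol.prod μ) := by
    refine (integrable_prod_iff' hm).2 ⟨Eventually.of_forall fun u => hκi.comp_sub_right (Z u), ?_⟩
    have : (fun u => ∫ z, ‖κ (z - Z u)‖ ∂vol) = fun _ => ∫ z, ‖κ z‖ ∂vol :=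
      funext fun u => integral_sub_right_eq_self (fun y => ‖κ y‖) (Z u)
    show Integrable (fun u => ∫ z, ‖κ (z - Z u)‖ ∂vol) μ
    rw [this]
    exact integrable_const _
  rw [integral_integral_swap hint]
  simp_rw [integral_sub_right_eq_self κ]
  simp

/-- **The reflected first-factor profile** `ζ ↦ ρ(c − ζ.1)` (constant in the energy variable):
`C¹`, bounded by the bounds of `ρ`, `∂_e = 0`, `∂_{(v,0)} = −Dρ(c − ζ.1)[v]`. This is the profile
`CEI(+ρ₁(w − ·))` used above the energy range. -/
theorem reflectedProfile_facts {E₁ : Type*} [NormedAddCommGroup E₁] [NormedSpace ℝ E₁]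
    {ρ : E₁ → ℝ} (hρ : ContDiff ℝ 1 ρ) {A : ℝ} (hA : ∀ x, |ρ x| ≤ A ∧ ‖fderiv ℝ ρ x‖ ≤ A) (c : E₁) :
    ContDiff ℝ 1 (fun ζ : E₁ × ℝ => ρ (c - ζ.1)) ∧
    (∀ ζ : E₁ × ℝ, |ρ (c - ζ.1)| ≤ A ∧ ‖fderiv ℝ (fun ζ : E₁ × ℝ => ρ (c - ζ.1)) ζ‖ ≤ A) ∧
    (∀ ζ : E₁ × ℝ, fderiv ℝ (fun ζ : E₁ × ℝ => ρ (c - ζ.1)) ζ (0, 1) = 0) ∧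
    (∀ (ζ : E₁ × ℝ) (v : E₁), fderiv ℝ (fun ζ : E₁ × ℝ => ρ (c - ζ.1)) ζ (v, 0) = -fderiv ℝ ρ (c - ζ.1) v) := by
  have hd : Differentiable ℝ ρ := hρ.differentiable one_ne_zero
  have hder : ∀ ζ : E₁ × ℝ, HasFDerivAt (fun ζ : E₁ × ℝ => ρ (c - ζ.1))
      ((fderiv ℝ ρ (c - ζ.1)).comp (0 - ContinuousLinearMap.fst ℝ E₁ ℝ)) ζ := fun ζ =>
    (hd (c - ζ.1)).hasFDerivAt.comp ζ ((hasFDerivAt_const c ζ).sub hasFDerivAt_fst)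
  have hval : ∀ (ζ : E₁ × ℝ) (w : E₁ × ℝ),
      fderiv ℝ (fun ζ : E₁ × ℝ => ρ (c - ζ.1)) ζ w = -fderiv ℝ ρ (c - ζ.1) w.1 := fun ζ w => by
    rw [(hder ζ).fderiv, zero_sub, ContinuousLinearMap.comp_apply, neg_apply, map_neg,
      ContinuousLinearMap.coe_fst']
  refine ⟨hρ.comp (contDiff_const.sub contDiff_fst), fun ζ => ⟨(hA _).1, ?_⟩, fun ζ => by simp [hval],
    fun ζ v => by rw [hval]⟩
  refine ContinuousLinearMap.opNorm_le_bound _ ((abs_nonneg _).trans (hA c).1) fun w => ?_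
  rw [hval, norm_neg]
  exact ((fderiv ℝ ρ (c - ζ.1)).le_opNorm w.1).trans
    (mul_le_mul (hA _).2 (norm_fst_le w) (norm_nonneg _) ((abs_nonneg _).trans (hA c).1))

/-- **Stub L3/Entry tools (generic).** Repackaging of the three facts above for the M1a prover:
(1) tensor kernels `a ⊗ b` with `a ∈ C¹` bounded with bounded derivative, `b' = ρ` continuous,
`|b| ≤ B`, `|ρ| ≤ C`, are `C¹`, bounded by `A B + A C` with derivative bounded by the same, and
`D(a ⊗ b)(y)[(v, s)] = Da(y.1)[v] b(y.2) + a(y.1) ρ(y.2) s`; (2) directional derivatives of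
the entries `∫ κ(· − Z u) F(u) dμ`; (3) the mass identity `∫∫ κ(z − Z u) dμ dz = ∫ κ`. -/
theorem stub_augCurrentLevelEntryTools {E₁ : Type*} [NormedAddCommGroup E₁] [NormedSpace ℝ E₁]
    {a : E₁ → ℝ} (ha : ContDiff ℝ 1 a) {b ρ : ℝ → ℝ} (hb : ∀ s, HasDerivAt b (ρ s) s) (hρ : Continuous ρ)
    {A B C : ℝ} (hA : ∀ x, |a x| ≤ A ∧ ‖fderiv ℝ a x‖ ≤ A) (hB : ∀ s, |b s| ≤ B) (hC : ∀ s, |ρ s| ≤ C) :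
    ContDiff ℝ 1 (fun y : E₁ × ℝ => a y.1 * b y.2) ∧
    (∀ y : E₁ × ℝ, |a y.1 * b y.2| ≤ A * B + A * C ∧
      ‖fderiv ℝ (fun y : E₁ × ℝ => a y.1 * b y.2) y‖ ≤ A * B + A * C) ∧
    (∀ (y : E₁ × ℝ) (v : E₁) (s : ℝ),
      fderiv ℝ (fun y : E₁ × ℝ => a y.1 * b y.2) y (v, s) = fderiv ℝ a y.1 v * b y.2 + a y.1 * (ρ y.2 * s)) := by
  have hb1 : ContDiff ℝ 1 b := by
    rw [contDiff_one_iff_deriv]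
    exact ⟨fun s => (hb s).differentiableAt, by rw [show deriv b = ρ from funext fun s => (hb s).deriv]; exact hρ⟩
  exact ⟨contDiff_tensorKernel ha hb1, tensorKernel_bounds ha hb hA hB hC,
    fun y v s => (fderiv_tensorKernel y ((ha.differentiable one_ne_zero) y.1) (hb y.2)).2.1 v s⟩

end Summit.AnomalousDissipation.AnomalousDissipation.Theorems.EnsembleRealization
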